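import Literature.Computability.AlgebraicComplexity.BI17Prop410OfPopov
import Literature.Computability.AlgebraicComplexity.BI17GenericPeriodTwoProofs
import Literature.RingTheory.KrullDimension.TangentDimension
import Literature.RingTheory.KrullDimension.ZariskiClosureInfinite
import Mathlib.LinearAlgebra.Matrix.Charpoly.Coeff
import HarnessLib

/-!
# Generic finiteness of the `SL_m × SL_m × SL_m`-stabilizer on `⊗³ℂ^m`: the Lie-algebra criterion,
# and the case `m = 3` by a kernel-checked certificate

Bürgisser–Ikenmeyer, *Fundamental invariants of orbit closures*, J. Algebra **477** (2017) 390–434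
= arXiv:1511.02927 [BurgisserIkenmeyer2017], §4: the proof of Prop. 4.10 ("Almost all
`w ∈ ⊗³ℂ^m` are polystable", TeX L1927–1937) feeds Popov's stability criterion for the semisimple
group `SL_m³` with the generic FINITENESS of the (reduced) stabilizer, which the print takes from
Thm. 4.2 (A. M. Popov's classification of generic stabilizers for `m ≥ 4`; for `m = 3` the
classification of `⊗³ℂ³`). The tree's edge `BI2017_prop_4_10_of_popov` (`BI17Prop410OfPopov.lean`,
val-lit-x4) carries the case `m = 3` as an explicit hypothesis `h3`. This file PROVES that
hypothesis, by the standard Lie-algebra (tangent-space) argument — the `⊗³` twin of the forms file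
`BI17FiniteStabilizerLocusProofs.lean` (`finite_linStabilizer_of_glAnn_eq_bot`):

* `HasTrivialSL3LieStabilizer w` — the traceless infinitesimal stabilizer
  `{(X,Y,Z) ∈ 𝔰𝔩_m³ | (X ⊗ 1 ⊗ 1 + 1 ⊗ Y ⊗ 1 + 1 ⊗ 1 ⊗ Z)·w = 0}` is zero; `sl3LieMatrix w` — the
  matrix of `(X,Y,Z) ↦ ((X ⊗ 1 ⊗ 1 + 1 ⊗ Y ⊗ 1 + 1 ⊗ 1 ⊗ Z)·w, tr X, tr Y, tr Z)` in coordinates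
  (`sl3LieMatrix_mulVec_inl`, `sl3LieMatrix_mulVec_inr`), so that `HasTrivialSL3LieStabilizer w` is
  injectivity of `sl3LieMatrix w` (`hasTrivialSL3LieStabilizer_of_mulVec_injective`).
* **`finite_slStabilizer_of_hasTrivialSL3LieStabilizer`** (every `m`, every `w`): a zero traceless
  infinitesimal stabilizer forces a finite `SL_m³`-stabilizer. Proof (Springer 4.3.3 (iii)): an
  infinite stabilizer is an infinite set of points of `(Mat_m)³ = 𝔸^{3m²}`, so a component of its
  Zariski closure is positive-dimensional (`KrullDimension.exists_mem_minimalPrimes_inter_infinite`)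
  and carries a stabilizer point `γ₀ = (G₀,G₁,G₂)` with a non-zero Zariski tangent vector
  `(B₀,B₁,B₂)` (`KrullDimension.height_le_finrank_tangentSpaceAt`); differentiating the stabilizer
  equations `((Y₀ ⊗ Y₁ ⊗ Y₂)·w)_{abc} = w_{abc}` and `det Yₛ = 1` along it with dual numbers
  (`KrullDimension.snd_aeval_dualNumberPoint`, `Matrix.det_one_add_smul`) and translating by
  `γ₀⁻¹` (`actTensor_actTensor`) exhibits the non-zero traceless triple `(G₀⁻¹B₀, G₁⁻¹B₁, G₂⁻¹B₂)`
  in the infinitesimal stabilizer. (Only this direction of the criterion is needed and proved.)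
* **`isZariskiGenericTensor_hasTrivialSL3LieStabilizer_of_certificate`** (every `m`): if an INTEGER
  matrix `G` and an integer tensor `w₀` satisfy `G · sl3LieMatrix w₀ = N · 1` with `N ≠ 0`, then
  `HasTrivialSL3LieStabilizer` holds for Zariski-almost all `w ∈ ⊗³ℂ^m` — off the hypersurface
  `det (G · sl3LieMatrix w) = 0`, a polynomial in the coordinates of `w` whose value at `w₀` is
  `N^{3m²}`.
* `m = 3`: the certificate `slStabCertMatrix * sl3LieMatrix slStabCertTensor = 3 • 1`
  (`slStabCertMatrix ∈ ℤ^{27×30}`, entries `|·| ≤ 4`; `slStabCertTensor` the `0/1` tensor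
  supported on `{002, 010, 100, 101, 112, 121, 122, 212, 221}`), checked by `decide +kernel`
  (`slStabCertMatrix_mul`); hence **`isZariskiGenericTensor_finite_slStabilizer_three`** —
  almost all `w ∈ ⊗³ℂ³` have a finite `SL₃³`-stabilizer — which is VERBATIM the hypothesis `h3` of
  `BI2017_prop_4_10_of_popov` / `BI2017_cor_5_12_of_popov`; the specialised edges
  `BI2017_prop_4_10_of_popov70_popov87`, `BI2017_cor_5_12_of_popov70_popov87` record that
  `BI2017_prop_4_10` and `BI2017_cor_5_12` now hang on the two Popov cite-facts only.

No named facts, no instances; definitions with bodies (`HasTrivialSL3LieStabilizer`,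
`sl3LieMatrix`, the certificate data). Honest framing: a classical genericity statement (in print via the
Thrall–Chanler/Nurmiev classification of `⊗³ℂ³`, here by a rank certificate); typed-literature
infrastructure for the cell `val-lit` (LADDER-VALIANT V3, a known-results layer); VP ≠ VNP is NOT
proved and nothing here bears on it.

## References

* [BurgisserIkenmeyer2017] P. Bürgisser, C. Ikenmeyer, *Fundamental invariants of orbit closures*,
  J. Algebra 477 (2017) 390–434 = arXiv:1511.02927, §4.1 (stabilizers, eq. (4.1)), Thm. 4.2,
  Prop. 4.10 (proof, L1927–1937).
* [SpringerLAG1998] T. A. Springer, *Linear Algebraic Groups*, 2nd ed., 4.1.2–4.3.3 (tangent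
  spaces; 4.3.3 (iii)), 4.4 (Lie algebra of a closed subgroup).
-/

set_option Elab.async false

noncomputable section

namespace Literature.Computability.AlgebraicComplexity

open MvPolynomial Matrix Literature.RingTheory.KrullDimension

/-- The three elements of `Fin 3`. [folklore] -/
private theorem fin3_eq (s : Fin 3) : s = 0 ∨ s = 1 ∨ s = 2 := by
  revert s; decide

/-! ### The traceless infinitesimal stabilizer and its matrix -/

section LieMatrix

variable {ι K : Type*} [Fintype ι] [DecidableEq ι] [CommRing K]

/-- **The traceless infinitesimal stabilizer of `w ∈ ⊗³K^ι` is zero**: for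
`X, Y, Z ∈ 𝔰𝔩(K^ι)` (trace zero), `(X ⊗ 1 ⊗ 1 + 1 ⊗ Y ⊗ 1 + 1 ⊗ 1 ⊗ Z)·w = 0` only for
`X = Y = Z = 0` — the Lie algebra of the `SL³`-stabilizer `{g ∈ SL³ | g·w = w}` (BI 2017 §4.1
eq. (4.1), intersected with `SL_m³`; proof of Prop. 4.10: "`stab'(w)` is finite for almost all `w`")
computed at the identity is trivial. The infinitesimal action is spelled with the tree's `actTensor`,
as in `lieStab_matMulTensor_iff` (`MatMulLieIsotropy.lean`).
[cite: BurgisserIkenmeyer2017, §4.1 eq. (4.1) and Prop. 4.10 (proof)] -/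
def HasTrivialSL3LieStabilizer (w : ι → ι → ι → K) : Prop :=
  ∀ X Y Z : Matrix ι ι K, X.trace = 0 → Y.trace = 0 → Z.trace = 0 →
    actTensor X (1 : Matrix ι ι K) (1 : Matrix ι ι K) w +
        actTensor (1 : Matrix ι ι K) Y (1 : Matrix ι ι K) w +
        actTensor (1 : Matrix ι ι K) (1 : Matrix ι ι K) Z w = 0 →
      X = 0 ∧ Y = 0 ∧ Z = 0

omit [Fintype ι] in
/-- **The matrix of the traceless infinitesimal action** `(X₀,X₁,X₂) ↦
((X₀ ⊗ 1 ⊗ 1 + 1 ⊗ X₁ ⊗ 1 + 1 ⊗ 1 ⊗ X₂)·w, tr X₀, tr X₁, tr X₂)` in coordinates: columns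
`(s,i,j)` = the entry `(Xₛ)_{ij}`, rows `inl (a,b,c)` = the tensor coordinate `abc` (entry
`[a=i] w_{jbc}`, `[b=i] w_{ajc}`, `[c=i] w_{abj}` for `s = 0, 1, 2`) and rows `inr s` = the trace of
`Xₛ` (entry `[i=j]`). [cite: BurgisserIkenmeyer2017, §4.1 (stabilizer) and Prop. 4.10 (proof)] -/
def sl3LieMatrix (w : ι → ι → ι → K) : Matrix ((ι × ι × ι) ⊕ Fin 3) (Fin 3 × ι × ι) K :=
  Matrix.of fun r c => Sum.elim
    (fun p : ι × ι × ι =>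
      ![if p.1 = c.2.1 then w c.2.2 p.2.1 p.2.2 else 0,
        if p.2.1 = c.2.1 then w p.1 c.2.2 p.2.2 else 0,
        if p.2.2 = c.2.1 then w p.1 p.2.1 c.2.2 else 0] c.1)
    (fun s : Fin 3 => if s = c.1 ∧ c.2.1 = c.2.2 then (1 : K) else 0) r

omit [Fintype ι] in
/-- `sl3LieMatrix` commutes with ring homomorphisms (its entries are coordinates of `w`, `0` or `1`).
[cite: BurgisserIkenmeyer2017, §4.1] -/
theorem sl3LieMatrix_map {L : Type*} [CommRing L] {F : Type*} [FunLike F K L] [RingHomClass F K L]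
    (f : F) (w : ι → ι → ι → K) :
    (sl3LieMatrix w).map f = sl3LieMatrix fun a b c => f (w a b c) := by
  ext r c
  obtain ⟨s, i, j⟩ := c
  rcases r with ⟨a, b, d⟩ | t
  · simp only [sl3LieMatrix, Matrix.map_apply, Matrix.of_apply, Sum.elim_inl]
    rcases fin3_eq s with rfl | rfl | rfl
    · simp only [Fin.isValue, Matrix.cons_val_zero]
      split_ifs <;> simp
    · simp only [Fin.isValue, Matrix.cons_val_one]
      split_ifs <;> simp
    · simp only [Fin.isValue, Matrix.cons_val_two, Matrix.tail_cons, Matrix.head_cons]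
      split_ifs <;> simp
  · simp only [sl3LieMatrix, Matrix.map_apply, Matrix.of_apply, Sum.elim_inr]
    split_ifs <;> simp

/-- The tensor rows of `sl3LieMatrix w · vec(X₀,X₁,X₂)` are the coordinates of
`(X₀ ⊗ 1 ⊗ 1 + 1 ⊗ X₁ ⊗ 1 + 1 ⊗ 1 ⊗ X₂)·w`. [cite: BurgisserIkenmeyer2017, §4.1] -/
theorem sl3LieMatrix_mulVec_inl (w : ι → ι → ι → K) (v : Fin 3 × ι × ι → K) (a b c : ι) :
    ((sl3LieMatrix w).mulVec v) (Sum.inl (a, b, c)) =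
      (actTensor (Matrix.of fun i j => v (0, i, j)) (1 : Matrix ι ι K) (1 : Matrix ι ι K) w +
        actTensor (1 : Matrix ι ι K) (Matrix.of fun i j => v (1, i, j)) (1 : Matrix ι ι K) w +
        actTensor (1 : Matrix ι ι K) (1 : Matrix ι ι K) (Matrix.of fun i j => v (2, i, j)) w)
        a b c := by
  simp only [Pi.add_apply, actTensor_fst_apply, actTensor_snd_apply, actTensor_thd_apply,
    Matrix.of_apply]
  rw [Matrix.mulVec, dotProduct, Fintype.sum_prod_type, Fin.sum_univ_three]
  simp only [sl3LieMatrix, Matrix.of_apply, Sum.elim_inl, Fintype.sum_prod_type, Fin.isValue,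
    Matrix.cons_val_zero, Matrix.cons_val_one, Matrix.cons_val_two, Matrix.head_cons,
    Matrix.tail_cons, ite_mul, zero_mul, Finset.sum_ite_eq, Finset.sum_ite_irrel,
    Finset.sum_const_zero, Finset.mem_univ, if_true]
  refine congrArg₂ _ (congrArg₂ _ ?_ ?_) ?_ <;>
    exact Finset.sum_congr rfl fun _ _ => mul_comm _ _

/-- The trace rows of `sl3LieMatrix w · vec(X₀,X₁,X₂)` are `tr Xₛ`. [cite: BurgisserIkenmeyer2017, §4.1] -/
theorem sl3LieMatrix_mulVec_inr (w : ι → ι → ι → K) (v : Fin 3 × ι × ι → K) (s : Fin 3) :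
    ((sl3LieMatrix w).mulVec v) (Sum.inr s) = (Matrix.of fun i j => v (s, i, j)).trace := by
  rw [Matrix.mulVec, dotProduct, Fintype.sum_prod_type, Matrix.trace]
  simp only [sl3LieMatrix, Matrix.of_apply, Sum.elim_inr, Fintype.sum_prod_type, Matrix.diag,
    ite_and, ite_mul, one_mul, zero_mul, Finset.sum_ite_eq, Finset.sum_ite_irrel,
    Finset.sum_const_zero, Finset.mem_univ, if_true]

/-- **Injectivity of `sl3LieMatrix w` is triviality of the traceless infinitesimal stabilizer.**
[cite: BurgisserIkenmeyer2017, §4.1 and Prop. 4.10 (proof)] -/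
theorem hasTrivialSL3LieStabilizer_of_mulVec_injective (w : ι → ι → ι → K)
    (hinj : Function.Injective (sl3LieMatrix w).mulVec) : HasTrivialSL3LieStabilizer w := by
  intro X Y Z hX hY hZ hsum
  let v : Fin 3 × ι × ι → K := fun p => ![X, Y, Z] p.1 p.2.1 p.2.2
  have e0 : (Matrix.of fun i j => v (0, i, j)) = X := Matrix.ext fun _ _ => rfl
  have e1 : (Matrix.of fun i j => v (1, i, j)) = Y := Matrix.ext fun _ _ => rfl
  have e2 : (Matrix.of fun i j => v (2, i, j)) = Z := Matrix.ext fun _ _ => rfl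
  have hv : (sl3LieMatrix w).mulVec v = 0 := by
    funext r
    rcases r with ⟨a, b, c⟩ | s
    · rw [sl3LieMatrix_mulVec_inl, e0, e1, e2, hsum]
      rfl
    · rw [sl3LieMatrix_mulVec_inr, Pi.zero_apply]
      rcases fin3_eq s with rfl | rfl | rfl
      · rw [e0, hX]
      · rw [e1, hY]
      · rw [e2, hZ]
  have hv0 : v = 0 := hinj (by rw [hv, Matrix.mulVec_zero])
  refine ⟨?_, ?_, ?_⟩
  · rw [← e0, hv0]; rfl
  · rw [← e1, hv0]; rfl
  · rw [← e2, hv0]; rfl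

end LieMatrix

/-! ### The Lie-algebra criterion: a zero infinitesimal stabilizer forces a finite stabilizer -/

section Finite

open TrivSqZeroExt DualNumber

variable {ι : Type*} [Fintype ι] [DecidableEq ι]

omit [DecidableEq ι] in
/-- Evaluating the generic action polynomial `((Y₀ ⊗ Y₁ ⊗ Y₂)·w)_{abc} ∈ ℂ[Y₀,Y₁,Y₂]` at a point
`y` of `(Mat)³` with values in a `ℂ`-algebra gives `((y₀ ⊗ y₁ ⊗ y₂)·w)_{abc}`. [folklore] -/
private theorem aeval_actTensor_X {R : Type*} [CommRing R] [Algebra ℂ R] (w : ι → ι → ι → ℂ)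
    (y : Fin 3 × ι × ι → R) (a b c : ι) :
    aeval y ((actTensor (Matrix.of fun i j => (X (0, i, j) : MvPolynomial (Fin 3 × ι × ι) ℂ))
        (Matrix.of fun i j => (X (1, i, j) : MvPolynomial (Fin 3 × ι × ι) ℂ))
        (Matrix.of fun i j => (X (2, i, j) : MvPolynomial (Fin 3 × ι × ι) ℂ))
        fun a b c => C (w a b c)) a b c) =
      actTensor (Matrix.of fun i j => y (0, i, j)) (Matrix.of fun i j => y (1, i, j))
        (Matrix.of fun i j => y (2, i, j)) (fun a b c => algebraMap ℂ R (w a b c)) a b c := by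
  simp only [actTensor_apply, map_sum, map_mul, aeval_X, aeval_C, Matrix.of_apply]

omit [DecidableEq ι] in
/-- The `ε`-part of `((A ⊗ B ⊗ C)·w)_{abc}` over the dual numbers `ℂ[ε]` (for a classical `w`) is
the sum of the three actions with one factor replaced by its `ε`-part. [folklore] -/
private theorem snd_actTensor_inl (A B C : Matrix ι ι ℂ[ε]) (w : ι → ι → ι → ℂ) (a b c : ι) :
    TrivSqZeroExt.snd (actTensor A B C (fun a b c => (inl (w a b c) : ℂ[ε])) a b c) =
      (actTensor (A.map TrivSqZeroExt.snd) (B.map TrivSqZeroExt.fst) (C.map TrivSqZeroExt.fst) w +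
        actTensor (A.map TrivSqZeroExt.fst) (B.map TrivSqZeroExt.snd) (C.map TrivSqZeroExt.fst) w +
        actTensor (A.map TrivSqZeroExt.fst) (B.map TrivSqZeroExt.fst) (C.map TrivSqZeroExt.snd) w)
        a b c := by
  simp only [actTensor_apply, Pi.add_apply, Matrix.map_apply, snd_sum, DualNumber.snd_mul, fst_mul,
    snd_inl, fst_inl, mul_zero, zero_add, ← Finset.sum_add_distrib]
  refine Finset.sum_congr rfl fun _ _ => Finset.sum_congr rfl fun _ _ =>
    Finset.sum_congr rfl fun _ _ => ?_
  ring

omit [DecidableEq ι] in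
/-- `(M·N)` mapped into the dual numbers: `inl` is multiplicative on matrices. [folklore] -/
private theorem map_inl_mul_map_inl (M N : Matrix ι ι ℂ) :
    M.map (inl : ℂ → ℂ[ε]) * N.map (inl : ℂ → ℂ[ε]) = (M * N).map inl := by
  ext i j
  · simp only [Matrix.mul_apply, Matrix.map_apply, fst_sum, fst_mul, fst_inl]
  · simp only [Matrix.mul_apply, Matrix.map_apply, snd_sum, DualNumber.snd_mul, fst_inl, snd_inl,
      mul_zero, zero_mul, add_zero, Finset.sum_const_zero]

/-- **The Lie-algebra criterion** (BI 2017 §4: the stabilizer of `w` in the semisimple group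
`SL_m³`; Springer 4.3.3 (iii)): if the traceless infinitesimal stabilizer of `w ∈ ⊗³ℂ^m` is zero,
then the `SL_m³`-stabilizer `{(g₀,g₁,g₂) ∈ SL_m³ | (g₀ ⊗ g₁ ⊗ g₂)·w = w}` is FINITE. If it is
infinite, the Zariski closure of this set of points of `(Mat_m)³` has a positive-dimensional
component `Z(𝔭)` (`exists_mem_minimalPrimes_inter_infinite`); at a stabilizer point
`γ₀ = (G₀,G₁,G₂) ∈ Z(𝔭)` the Zariski tangent space is non-zero (`height_le_finrank_tangentSpaceAt`);
a tangent vector `(B₀,B₁,B₂) ≠ 0` kills the differentials of the stabilizer equations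
`((Y₀ ⊗ Y₁ ⊗ Y₂)·w)_{abc} − w_{abc} ∈ 𝔭` and `det Yₛ − 1 ∈ 𝔭`, i.e. (dual numbers)
`(B₀ ⊗ G₁ ⊗ G₂ + G₀ ⊗ B₁ ⊗ G₂ + G₀ ⊗ G₁ ⊗ B₂)·w = 0` and `tr(Gₛ⁻¹Bₛ) = 0`; applying
`(G₀⁻¹ ⊗ G₁⁻¹ ⊗ G₂⁻¹)` and `(G₀ ⊗ G₁ ⊗ G₂)·w = w` gives the non-zero traceless triple
`(G₀⁻¹B₀, G₁⁻¹B₁, G₂⁻¹B₂)` in the infinitesimal stabilizer. [cite: SpringerLAG1998, Thm 4.3.3 (iii)] -/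
theorem finite_slStabilizer_of_hasTrivialSL3LieStabilizer (w : ι → ι → ι → ℂ)
    (h : HasTrivialSL3LieStabilizer w) :
    {g : Matrix.SpecialLinearGroup ι ℂ × Matrix.SpecialLinearGroup ι ℂ ×
        Matrix.SpecialLinearGroup ι ℂ |
      actTensor (g.1 : Matrix ι ι ℂ) (g.2.1 : Matrix ι ι ℂ) (g.2.2 : Matrix ι ι ℂ) w = w}.Finite := by
  classical
  by_contra hinf
  -- a triple of matrices as a point of the affine space `(Fin 3 × ι × ι → ℂ)`
  let trip : Matrix.SpecialLinearGroup ι ℂ × Matrix.SpecialLinearGroup ι ℂ ×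
      Matrix.SpecialLinearGroup ι ℂ → Fin 3 → Matrix ι ι ℂ :=
    fun g => ![(g.1 : Matrix ι ι ℂ), (g.2.1 : Matrix ι ι ℂ), (g.2.2 : Matrix ι ι ℂ)]
  let pt : Matrix.SpecialLinearGroup ι ℂ × Matrix.SpecialLinearGroup ι ℂ ×
      Matrix.SpecialLinearGroup ι ℂ → (Fin 3 × ι × ι → ℂ) := fun g p => trip g p.1 p.2.1 p.2.2
  have hdet : ∀ (γ : Matrix.SpecialLinearGroup ι ℂ × Matrix.SpecialLinearGroup ι ℂ ×
      Matrix.SpecialLinearGroup ι ℂ) (s : Fin 3), (trip γ s).det = 1 := by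
    intro γ s
    rcases fin3_eq s with rfl | rfl | rfl
    exacts [γ.1.det_coe, γ.2.1.det_coe, γ.2.2.det_coe]
  have hpt_inj : Function.Injective pt := by
    intro g g' hgg'
    have hc : ∀ s : Fin 3, trip g s = trip g' s := fun s =>
      Matrix.ext fun i j => congr_fun hgg' (s, i, j)
    refine Prod.ext ?_ (Prod.ext ?_ ?_)
    · exact Matrix.SpecialLinearGroup.ext _ _ fun i j => congr_fun (congr_fun (hc 0) i) j
    · exact Matrix.SpecialLinearGroup.ext _ _ fun i j => congr_fun (congr_fun (hc 1) i) j
    · exact Matrix.SpecialLinearGroup.ext _ _ fun i j => congr_fun (congr_fun (hc 2) i) j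
  set S : Set (Fin 3 × ι × ι → ℂ) := pt '' {g : Matrix.SpecialLinearGroup ι ℂ ×
      Matrix.SpecialLinearGroup ι ℂ × Matrix.SpecialLinearGroup ι ℂ |
    actTensor (g.1 : Matrix ι ι ℂ) (g.2.1 : Matrix ι ι ℂ) (g.2.2 : Matrix ι ι ℂ) w = w} with hS
  have hSinf : S.Infinite := Set.Infinite.image hpt_inj.injOn hinf
  obtain ⟨𝔭, h𝔭min, hinf', -, hnotmax, -⟩ :=
    exists_mem_minimalPrimes_inter_infinite (k := ℂ) (K := ℂ) hSinf
  haveI h𝔭 : 𝔭.IsPrime := h𝔭min.1.1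
  have hIS : MvPolynomial.vanishingIdeal ℂ S ≤ 𝔭 := h𝔭min.1.2
  obtain ⟨a, haS, ha𝔭⟩ := hinf'.nonempty
  obtain ⟨γ₀, hγ₀, rfl⟩ := haS
  have hγ₀w : actTensor (trip γ₀ 0) (trip γ₀ 1) (trip γ₀ 2) w = w := hγ₀
  have ha : ∀ p ∈ 𝔭, eval (pt γ₀) p = 0 := fun p hp => by
    rw [← aeval_apply_eq_eval]; exact (MvPolynomial.mem_zeroLocus_iff.mp ha𝔭) p hp
  -- the maximal ideal of `γ₀` in `ℂ[Y] ⧸ 𝔭` has positive height, so the tangent space is non-zero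
  haveI : IsDomain (MvPolynomial (Fin 3 × ι × ι) ℂ ⧸ 𝔭) := Ideal.Quotient.isDomain 𝔭
  have hnf : ¬ IsField (MvPolynomial (Fin 3 × ι × ι) ℂ ⧸ 𝔭) := fun hF =>
    hnotmax ((Ideal.Quotient.maximal_ideal_iff_isField_quotient 𝔭).mpr hF)
  haveI := isMaximal_pointIdeal (pointOfZero 𝔭 (pt γ₀) ha)
  have hbot : ⊥ < pointIdeal (pointOfZero 𝔭 (pt γ₀) ha) := Ideal.bot_lt_of_maximal _ hnf
  have hheight : (pointIdeal (pointOfZero 𝔭 (pt γ₀) ha)).height ≠ 0 := by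
    rw [Ne, Ideal.height_eq_zero_iff_eq_bot]
    exact hbot.ne'
  have h1 : (1 : ℕ∞) ≤ Module.finrank ℂ (tangentSpaceAt 𝔭 (pt γ₀)) :=
    (Order.one_le_iff_ne_zero.mpr hheight).trans (height_le_finrank_tangentSpaceAt 𝔭 (pt γ₀) ha)
  have h1' : 0 < Module.finrank ℂ (tangentSpaceAt 𝔭 (pt γ₀)) := by
    have : (1 : ℕ) ≤ Module.finrank ℂ (tangentSpaceAt 𝔭 (pt γ₀)) := by exact_mod_cast h1
    omega
  obtain ⟨v, hv⟩ := Module.finrank_pos_iff_exists_ne_zero.mp h1'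
  -- the tangent vector as three matrices `Bₛ`; the inverses `Gₛ⁻¹`; `Nₛ = Gₛ⁻¹ Bₛ`
  let B : Fin 3 → Matrix ι ι ℂ := fun s => Matrix.of fun i j => (v : Fin 3 × ι × ι → ℂ) (s, i, j)
  let Gi : Fin 3 → Matrix ι ι ℂ :=
    ![((γ₀.1⁻¹ : Matrix.SpecialLinearGroup ι ℂ) : Matrix ι ι ℂ),
      ((γ₀.2.1⁻¹ : Matrix.SpecialLinearGroup ι ℂ) : Matrix ι ι ℂ),
      ((γ₀.2.2⁻¹ : Matrix.SpecialLinearGroup ι ℂ) : Matrix ι ι ℂ)]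
  have aux₁ : ∀ γ : Matrix.SpecialLinearGroup ι ℂ,
      ((γ⁻¹ : Matrix.SpecialLinearGroup ι ℂ) : Matrix ι ι ℂ) * (γ : Matrix ι ι ℂ) = 1 := fun γ => by
    rw [← Matrix.SpecialLinearGroup.coe_mul, inv_mul_cancel, Matrix.SpecialLinearGroup.coe_one]
  have aux₂ : ∀ γ : Matrix.SpecialLinearGroup ι ℂ,
      (γ : Matrix ι ι ℂ) * ((γ⁻¹ : Matrix.SpecialLinearGroup ι ℂ) : Matrix ι ι ℂ) = 1 := fun γ => by
    rw [← Matrix.SpecialLinearGroup.coe_mul, mul_inv_cancel, Matrix.SpecialLinearGroup.coe_one]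
  have hGiG : ∀ s, Gi s * trip γ₀ s = 1 := by
    intro s
    rcases fin3_eq s with rfl | rfl | rfl
    exacts [aux₁ γ₀.1, aux₁ γ₀.2.1, aux₁ γ₀.2.2]
  have hGGi : ∀ s, trip γ₀ s * Gi s = 1 := by
    intro s
    rcases fin3_eq s with rfl | rfl | rfl
    exacts [aux₂ γ₀.1, aux₂ γ₀.2.1, aux₂ γ₀.2.2]
  let N : Fin 3 → Matrix ι ι ℂ := fun s => Gi s * B s
  have hGN : ∀ s, trip γ₀ s * N s = B s := fun s => by
    show trip γ₀ s * (Gi s * B s) = B s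
    rw [← Matrix.mul_assoc, hGGi, Matrix.one_mul]
  -- the matrices of the dual-number point `γ₀ + ε B`
  have hfst : ∀ s, (Matrix.of fun i j => dualNumberPoint (pt γ₀) (v : Fin 3 × ι × ι → ℂ)
      (s, i, j)).map TrivSqZeroExt.fst = trip γ₀ s := by
    intro s; ext i j
    simp only [Matrix.map_apply, Matrix.of_apply, fst_dualNumberPoint]
    rfl
  have hsnd : ∀ s, (Matrix.of fun i j => dualNumberPoint (pt γ₀) (v : Fin 3 × ι × ι → ℂ)
      (s, i, j)).map TrivSqZeroExt.snd = B s := by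
    intro s; ext i j
    simp only [Matrix.map_apply, Matrix.of_apply, snd_dualNumberPoint]
    rfl
  -- (K1) the differentiated action equations, translated by `γ₀⁻¹`
  have K1 : actTensor (N 0) (1 : Matrix ι ι ℂ) (1 : Matrix ι ι ℂ) w +
      actTensor (1 : Matrix ι ι ℂ) (N 1) (1 : Matrix ι ι ℂ) w +
      actTensor (1 : Matrix ι ι ℂ) (1 : Matrix ι ι ℂ) (N 2) w = 0 := by
    have hD : actTensor (B 0) (trip γ₀ 1) (trip γ₀ 2) w + actTensor (trip γ₀ 0) (B 1) (trip γ₀ 2) w +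
        actTensor (trip γ₀ 0) (trip γ₀ 1) (B 2) w = 0 := by
      funext a b c
      let P : MvPolynomial (Fin 3 × ι × ι) ℂ :=
        actTensor (Matrix.of fun i j => (X (0, i, j) : MvPolynomial (Fin 3 × ι × ι) ℂ))
          (Matrix.of fun i j => (X (1, i, j) : MvPolynomial (Fin 3 × ι × ι) ℂ))
          (Matrix.of fun i j => (X (2, i, j) : MvPolynomial (Fin 3 × ι × ι) ℂ))
          (fun a b c => C (w a b c)) a b c - C (w a b c)
      have hPmem : P ∈ 𝔭 := by
        apply hIS
        rw [MvPolynomial.mem_vanishingIdeal_iff]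
        rintro _ ⟨γ, hγ, rfl⟩
        have hγw : actTensor (trip γ 0) (trip γ 1) (trip γ 2) w = w := hγ
        show aeval (pt γ) (actTensor _ _ _ _ a b c - C (w a b c)) = 0
        rw [map_sub, aeval_C, aeval_actTensor_X, Algebra.algebraMap_self_apply]
        have e : (fun a b c => algebraMap ℂ ℂ (w a b c)) = w := rfl
        rw [e]
        change actTensor (trip γ 0) (trip γ 1) (trip γ 2) w a b c - w a b c = 0
        rw [hγw, sub_self]
      have htan : linearFormOfVector (pt γ₀) (v : Fin 3 × ι × ι → ℂ) P = 0 :=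
        linearFormOfVector_eq_zero 𝔭 (pt γ₀) v _ hPmem
      have hε := snd_aeval_dualNumberPoint (pt γ₀) (v : Fin 3 × ι × ι → ℂ) P
      rw [htan] at hε
      change TrivSqZeroExt.snd (aeval (dualNumberPoint (pt γ₀) (v : Fin 3 × ι × ι → ℂ))
        (actTensor _ _ _ _ a b c - C (w a b c))) = 0 at hε
      rw [map_sub, aeval_C, aeval_actTensor_X, TrivSqZeroExt.algebraMap_eq_inl, snd_sub, snd_inl,
        sub_zero] at hε
      have e : (fun a b c => (inl (w a b c) : ℂ[ε])) = fun a b c => (inl (w a b c) : ℂ[ε]) := rfl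
      rw [snd_actTensor_inl, hsnd 0, hsnd 1, hsnd 2, hfst 0, hfst 1, hfst 2] at hε
      rw [hε]
      rfl
    have h2 := congrArg (actTensor (Gi 0) (Gi 1) (Gi 2)) hD
    rw [actTensor_zero, actTensor_add_tensor, actTensor_add_tensor, actTensor_actTensor,
      actTensor_actTensor, actTensor_actTensor, hGiG 0, hGiG 1, hGiG 2] at h2
    exact h2
  -- (K2) the differentiated determinant equations: `tr Nₛ = 0`
  have K2 : ∀ s : Fin 3, (N s).trace = 0 := by
    intro s
    let Q : MvPolynomial (Fin 3 × ι × ι) ℂ :=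
      (Matrix.of fun i j => (X (s, i, j) : MvPolynomial (Fin 3 × ι × ι) ℂ)).det - 1
    have hmapQ : ∀ {R : Type} [CommRing R] [Algebra ℂ R] (y : Fin 3 × ι × ι → R),
        aeval y Q = (Matrix.of fun i j => y (s, i, j)).det - 1 := by
      intro R _ _ y
      show aeval y ((Matrix.of fun i j => (X (s, i, j) : MvPolynomial (Fin 3 × ι × ι) ℂ)).det - 1) = _
      rw [map_sub, map_one, AlgHom.map_det, AlgHom.mapMatrix_apply]
      congr 2
      ext i j
      simp only [Matrix.map_apply, Matrix.of_apply, aeval_X]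
    have hQmem : Q ∈ 𝔭 := by
      apply hIS
      rw [MvPolynomial.mem_vanishingIdeal_iff]
      rintro _ ⟨γ, _, rfl⟩
      rw [hmapQ]
      change (trip γ s).det - 1 = 0
      rw [hdet γ s, sub_self]
    have htan : linearFormOfVector (pt γ₀) (v : Fin 3 × ι × ι → ℂ) Q = 0 :=
      linearFormOfVector_eq_zero 𝔭 (pt γ₀) v _ hQmem
    have hε := snd_aeval_dualNumberPoint (pt γ₀) (v : Fin 3 × ι × ι → ℂ) Q
    rw [htan, hmapQ] at hε
    -- `γ₀ + ε B = G (1 + ε N)` in the `s`-th component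
    have hGε : (Matrix.of fun i j => dualNumberPoint (pt γ₀) (v : Fin 3 × ι × ι → ℂ) (s, i, j)) =
        (trip γ₀ s).map inl * (1 + (ε : ℂ[ε]) • (N s).map inl) := by
      rw [Matrix.mul_add, Matrix.mul_one, Matrix.mul_smul, map_inl_mul_map_inl, hGN]
      ext i j
      · simp only [Matrix.of_apply, dualNumberPoint, Matrix.add_apply, Matrix.map_apply,
          Matrix.smul_apply, smul_eq_mul, fst_add, fst_inl, fst_inr, fst_mul, fst_eps, zero_mul,
          add_zero]
        rfl
      · simp only [Matrix.of_apply, dualNumberPoint, Matrix.add_apply, Matrix.map_apply,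
          Matrix.smul_apply, smul_eq_mul, snd_add, snd_inl, snd_inr, DualNumber.snd_mul, fst_eps,
          snd_eps, fst_inl, zero_mul, one_mul, zero_add]
        rfl
    have hdet1 : ((trip γ₀ s).map inl : Matrix ι ι ℂ[ε]).det = 1 := by
      have h := RingHom.map_det (TrivSqZeroExt.inlHom ℂ ℂ) (trip γ₀ s)
      rw [hdet γ₀ s, map_one] at h
      rw [h]
      rfl
    rw [hGε, Matrix.det_mul, hdet1, one_mul, Matrix.det_one_add_smul, sq, eps_mul_eps, mul_zero,
      add_zero, add_sub_cancel_left, DualNumber.snd_mul, snd_eps, fst_eps, mul_one, mul_zero,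
      add_zero] at hε
    -- `fst (tr (N.map inl)) = tr N`
    rw [Matrix.trace, fst_sum] at hε
    rw [Matrix.trace, ← hε]
    refine Finset.sum_congr rfl fun i _ => ?_
    simp only [Matrix.diag_apply, Matrix.map_apply, fst_inl]
  -- conclusion: `N = 0`, hence `B = 0`, hence `v = 0`
  obtain ⟨hN0, hN1, hN2⟩ := h (N 0) (N 1) (N 2) (K2 0) (K2 1) (K2 2) K1
  have hN : ∀ s, N s = 0 := by
    intro s
    rcases fin3_eq s with rfl | rfl | rfl
    exacts [hN0, hN1, hN2]
  apply hv
  apply Subtype.ext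
  funext p
  obtain ⟨s, i, j⟩ := p
  have hB : B s = 0 := by rw [← hGN s, hN s, Matrix.mul_zero]
  have hij := congr_fun (congr_fun hB i) j
  change (v : Fin 3 × ι × ι → ℂ) (s, i, j) = 0 at hij
  rw [hij]
  rfl

end Finite

/-! ### Genericity from an integer certificate -/

section Certificate

variable {ι : Type*} [Fintype ι] [DecidableEq ι]

/-- **Generic triviality of the infinitesimal stabilizer from ONE certified point.** If integer
data `G`, `w₀`, `N ≠ 0` satisfy `G · sl3LieMatrix w₀ = N · 1`, then for Zariski-almost all
`w ∈ ⊗³ℂ^ι` the traceless infinitesimal stabilizer is zero: the test polynomial is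
`F(w) = det (G · sl3LieMatrix w)` (entries of `sl3LieMatrix` are linear in the coordinates of `w`), with
`F(w₀) = N^{3m²} ≠ 0`, and `F(w) ≠ 0` makes `sl3LieMatrix w` injective.
[cite: BurgisserIkenmeyer2017, §4.1 ("almost all") and Prop. 4.10 (proof)] -/
theorem isZariskiGenericTensor_hasTrivialSL3LieStabilizer_of_certificate
    (G : Matrix (Fin 3 × ι × ι) ((ι × ι × ι) ⊕ Fin 3) ℤ) (w₀ : ι → ι → ι → ℤ) (N : ℤ) (hN : N ≠ 0)
    (hcert : G * sl3LieMatrix w₀ = N • (1 : Matrix (Fin 3 × ι × ι) (Fin 3 × ι × ι) ℤ)) :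
    IsZariskiGenericTensor
      (fun w : ι → ι → ι → ℂ => HasTrivialSL3LieStabilizer w) := by
  classical
  -- the generic matrix and the test polynomial
  let Mgen : Matrix ((ι × ι × ι) ⊕ Fin 3) (Fin 3 × ι × ι) (MvPolynomial (ι × ι × ι) ℂ) :=
    sl3LieMatrix fun a b c => X (a, b, c)
  let Gc : Matrix (Fin 3 × ι × ι) ((ι × ι × ι) ⊕ Fin 3) ℂ := G.map (Int.castRingHom ℂ)
  let F : MvPolynomial (ι × ι × ι) ℂ :=
    (Gc.map (C : ℂ →+* MvPolynomial (ι × ι × ι) ℂ) * Mgen).det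
  have hevalM : ∀ w : ι → ι → ι → ℂ, Mgen.map (aeval (tensorPt w)) = sl3LieMatrix w := by
    intro w
    show (sl3LieMatrix fun a b c => (X (a, b, c) : MvPolynomial (ι × ι × ι) ℂ)).map
      (aeval (tensorPt w)) = sl3LieMatrix w
    rw [sl3LieMatrix_map]
    congr 1
    funext a b c
    rw [aeval_X]
    rfl
  have hevalG : ∀ w : ι → ι → ι → ℂ,
      (Gc.map (C : ℂ →+* MvPolynomial (ι × ι × ι) ℂ)).map (aeval (tensorPt w)) = Gc := by
    intro w
    ext r c
    simp only [Matrix.map_apply, aeval_C, Algebra.algebraMap_self_apply]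
  have hevalF : ∀ w : ι → ι → ι → ℂ, aeval (tensorPt w) F = (Gc * sl3LieMatrix w).det := by
    intro w
    show aeval (tensorPt w) (Gc.map (C : ℂ →+* MvPolynomial (ι × ι × ι) ℂ) * Mgen).det = _
    rw [AlgHom.map_det, AlgHom.mapMatrix_apply, Matrix.map_mul, hevalM, hevalG]
  refine ⟨F, ?_, fun w hw => ?_⟩
  · -- `F ≠ 0`: its value at `w₀` is `N ^ (3m²)`
    intro hF0
    have h1 := hevalF (fun a b c => (w₀ a b c : ℂ))
    rw [hF0, map_zero] at h1
    have h2 : Gc * sl3LieMatrix (fun a b c => (w₀ a b c : ℂ)) =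
        (N : ℂ) • (1 : Matrix (Fin 3 × ι × ι) (Fin 3 × ι × ι) ℂ) := by
      have hm : (sl3LieMatrix fun a b c => (w₀ a b c : ℂ)) =
          (sl3LieMatrix w₀).map (Int.castRingHom ℂ) := by
        rw [sl3LieMatrix_map]
        rfl
      rw [hm]
      show G.map (Int.castRingHom ℂ) * (sl3LieMatrix w₀).map (Int.castRingHom ℂ) = _
      rw [← Matrix.map_mul, hcert]
      ext r c
      simp only [Matrix.map_apply, Matrix.smul_apply, Matrix.one_apply, smul_eq_mul, mul_ite,
        mul_one, mul_zero, eq_intCast, Int.cast_ite, Int.cast_zero]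
    rw [h2, Matrix.det_smul, Matrix.det_one, mul_one] at h1
    exact pow_ne_zero _ (Int.cast_ne_zero.mpr hN) h1.symm
  · -- `F(w) ≠ 0 ⇒ sl3LieMatrix w` injective
    rw [hevalF] at hw
    apply hasTrivialSL3LieStabilizer_of_mulVec_injective
    intro v v' hvv'
    rw [← sub_eq_zero]
    apply Matrix.eq_zero_of_mulVec_eq_zero hw
    rw [← Matrix.mulVec_mulVec, Matrix.mulVec_sub, hvv', sub_self, Matrix.mulVec_zero]

/-- Hence, from such a certificate, **almost all `w ∈ ⊗³ℂ^ι` have a finite `SL³`-stabilizer**.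
[cite: BurgisserIkenmeyer2017, Prop. 4.10 (proof: "`stab'(w)` is finite for almost all `w`")] -/
theorem isZariskiGenericTensor_finite_slStabilizer_of_certificate
    (G : Matrix (Fin 3 × ι × ι) ((ι × ι × ι) ⊕ Fin 3) ℤ) (w₀ : ι → ι → ι → ℤ) (N : ℤ) (hN : N ≠ 0)
    (hcert : G * sl3LieMatrix w₀ = N • (1 : Matrix (Fin 3 × ι × ι) (Fin 3 × ι × ι) ℤ)) :
    IsZariskiGenericTensor fun w : ι → ι → ι → ℂ =>
      {g : Matrix.SpecialLinearGroup ι ℂ × Matrix.SpecialLinearGroup ι ℂ ×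
          Matrix.SpecialLinearGroup ι ℂ |
        actTensor (g.1 : Matrix ι ι ℂ) (g.2.1 : Matrix ι ι ℂ) (g.2.2 : Matrix ι ι ℂ) w = w}.Finite :=
  (isZariskiGenericTensor_hasTrivialSL3LieStabilizer_of_certificate G w₀ N hN hcert).mono
    fun w hw => finite_slStabilizer_of_hasTrivialSL3LieStabilizer w hw

end Certificate

/-! ### The certificate for `m = 3` -/

section Three

/-- The certificate matrix for `m = 3`, as a `27 × 30` integer table (rows: the coordinate `(s,i,j)`
of `𝔤𝔩₃³` at position `9s + 3i + j`; columns: the tensor coordinate `abc` at `9a + 3b + c`, then the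
three traces at `27 + s`): `3 ·` a left inverse of `sl3LieMatrix slStabCertTensor` restricted to 27 of its
30 rows (found by exact rational linear algebra; entries `|·| ≤ 4`). [folklore] -/
def slStabCertTable : Fin 27 → Fin 30 → ℤ :=
  ![![0, 0, 0, -1, 1, 0, 0, 0, 0, -2, -1, 0, 0, 0, 0, 0, 0, -1, 2, 1, 0, 0, 0, -2, 2, -2, 1, 4, 3, 3],
    ![-1, 4, 0, 0, 0, 0, 0, 0, 0, 0, 0, 0, 0, 0, 2, 2, -2, 0, 0, 0, 1, -1, -2, -2, -2, 2, 0, 0, 0, 0],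
    ![1, -4, 0, 0, 0, 0, 0, 3, 0, 0, 0, 0, 0, 0, -2, -2, 2, 0, 0, 0, -1, 1, 2, 2, 2, -2, 0, 0, 0, 0],
    ![-2, 2, 0, 0, 0, 0, 0, 0, 0, 0, 0, 0, 3, -3, 1, 1, -1, 0, 0, 0, 2, -2, 2, -1, -1, 1, 0, 0, 0, 0],
    ![0, 0, 0, 2, -2, 0, 0, 0, 0, 1, 2, 0, 0, 0, 0, 0, 0, 2, 2, -2, 0, 0, 0, 1, -1, 1, -2, -2, -3, -3],
    ![1, -1, 0, -3, 3, 0, 0, 0, 0, 0, -3, 0, 0, 0, 1, -2, 2, -3, -3, 3, -1, 1, -1, -1, 2, -2, 3, 3, 3, 3],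
    ![-2, 2, 0, 0, 0, 0, 0, 0, 0, 0, 0, 0, 0, 0, 1, 1, -1, 0, 0, 0, 2, 1, -1, -1, -1, 1, 0, 0, 0, 0],
    ![0, 0, 0, 0, 0, 0, 0, 0, 0, 0, 0, 0, 0, 0, 0, 0, 0, 0, 3, 0, 0, 0, 0, 0, 0, 0, 0, 0, 0, 0],
    ![0, 0, 0, -1, 1, 0, 0, 0, 0, 1, -1, 0, 0, 0, 0, 0, 0, -1, -4, 1, 0, 0, 0, 1, -1, 1, 1, 1, 0, 0],
    ![0, 0, 0, -3, 1, 0, 0, 0, 0, 0, -1, 0, 0, 0, 0, 0, 0, -2, 0, 1, 0, 0, 0, -1, 0, -2, 2, 3, 4, 3],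
    ![2, -2, 0, 0, 0, 0, 0, 0, 0, 0, 0, 0, 0, 0, -1, -1, 1, 0, 0, 0, 1, -1, 1, 1, 1, -1, 0, 0, 0, 0],
    ![0, 0, 0, 0, 0, 0, 0, 0, 0, 0, 0, 0, 0, 0, 0, 0, 0, 0, -3, 3, 0, 0, 0, 0, 0, 0, 0, 0, 0, 0],
    ![0, 0, 0, 0, 0, 0, 0, 0, 0, 0, 0, 0, 0, 3, 0, 0, 0, 0, 0, 0, 0, 0, -3, 0, 0, 0, 0, 0, 0, 0],
    ![0, 0, 0, 3, -2, 0, 0, 0, 0, 0, 2, 0, 0, 0, 0, 0, 0, 1, 0, -2, 0, 0, 0, 2, 0, 1, -1, -3, -2, -3],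
    ![-1, 1, 0, 0, 0, 0, 0, 0, 0, 0, 0, 0, 0, 0, 2, 2, -2, 0, 0, 0, 1, -1, 1, -2, -2, 2, 0, 0, 0, 0],
    ![-2, 2, 0, 0, 0, 0, 0, 0, 0, 0, 0, 0, 0, 0, 1, 4, -1, 0, 0, 0, 2, -2, -1, -1, -4, 1, 0, 0, 0, 0],
    ![0, 0, 0, 0, 0, 0, 3, 0, 0, 0, 0, 0, 0, 0, 0, 0, 0, 0, 0, 0, 0, 0, 0, 0, 0, 0, 0, 0, 0, 0],
    ![0, 0, 0, 0, 1, 0, 0, 0, 0, 0, -1, 0, 0, 0, 0, 0, 0, 1, 0, 1, 0, 0, 0, -1, 0, 1, -1, 0, 1, 0],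
    ![0, 0, 0, 1, 1, 0, 0, 0, 0, 2, -1, 0, 0, 0, 0, 0, 0, 0, -2, 1, 0, 0, 0, 0, -2, 1, 0, -1, -1, 0],
    ![0, 0, 0, 0, 0, 0, 0, 0, 0, 0, 0, 0, 0, 0, 0, 0, 0, 0, 0, 0, 0, 0, 0, 0, 3, 0, 0, 0, 0, 0],
    ![2, -2, 0, 0, 0, 0, 0, 0, 0, 0, 0, 0, 0, 0, -1, -1, 1, 0, 0, 0, -2, 2, 1, 1, 1, -1, 0, 0, 0, 0],
    ![0, 0, 0, 0, 3, 0, 0, 0, 0, 0, 0, 0, 0, 0, 0, 0, 0, 0, 0, 0, 0, 0, 0, 0, 0, 0, 0, 0, 0, 0],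
    ![0, 0, 0, 1, -2, 0, 0, 0, 0, -1, 2, 0, 0, 0, 0, 0, 0, 0, 1, -2, 0, 0, 0, 0, 1, 1, 0, -1, -1, 0],
    ![1, -1, 0, 0, 0, 0, 0, 0, 0, 0, 0, 0, 0, 0, -2, -2, 2, 0, 0, 0, -1, 1, 2, 2, 2, -2, 0, 0, 0, 0],
    ![0, 0, 0, 0, 0, 3, 0, -3, 0, 0, 0, 0, 0, -3, 0, 0, 0, 0, 0, 0, 0, 0, 3, 0, 0, 0, 0, 0, 0, 0],
    ![0, 0, 0, 0, 0, 0, -3, 0, 0, 0, 0, 0, 0, 0, 0, 0, 0, 0, -3, 0, 0, 0, 0, 0, 0, 0, 3, 0, 0, 0],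
    ![0, 0, 0, -2, 1, 0, 0, 0, 0, -1, -1, 0, 0, 0, 0, 0, 0, 0, 1, 1, 0, 0, 0, 0, 1, -2, 0, 2, 2, 3]]

/-- The witness tensor `w₀ ∈ ⊗³ℤ³`: the `0/1` tensor supported on
`{002, 010, 100, 101, 112, 121, 122, 212, 221}` (a point at which `sl3LieMatrix` has full rank `27`).
[folklore] -/
def slStabCertTensor : Fin 3 → Fin 3 → Fin 3 → ℤ :=
  ![![![0, 0, 1], ![1, 0, 0], ![0, 0, 0]], ![![1, 1, 0], ![0, 0, 1], ![0, 1, 1]],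
    ![![0, 0, 0], ![0, 0, 1], ![0, 1, 0]]]

/-- The position `9s + 3i + j ∈ Fin 27` of a triple `(s,i,j) ∈ (Fin 3)³`. [folklore] -/
def fin333Enc (p : Fin 3 × Fin 3 × Fin 3) : Fin 27 :=
  ⟨9 * (p.1 : ℕ) + 3 * (p.2.1 : ℕ) + (p.2.2 : ℕ), by
    have := p.1.isLt; have := p.2.1.isLt; have := p.2.2.isLt; omega⟩

/-- The certificate matrix `G ∈ ℤ^{27 × 30}` for `m = 3`, indexed like `sl3LieMatrix`ᵀ.
[folklore] -/
def slStabCertMatrix : Matrix (Fin 3 × Fin 3 × Fin 3) ((Fin 3 × Fin 3 × Fin 3) ⊕ Fin 3) ℤ :=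
  Matrix.of fun r c => slStabCertTable (fin333Enc r)
    (Sum.elim (fun p : Fin 3 × Fin 3 × Fin 3 =>
        (⟨(fin333Enc p : ℕ), by have := (fin333Enc p).isLt; omega⟩ : Fin 30))
      (fun s : Fin 3 => (⟨27 + (s : ℕ), by have := s.isLt; omega⟩ : Fin 30)) c)

/-- **The certificate, kernel-checked**: `slStabCertMatrix · sl3LieMatrix slStabCertTensor = 3 · 1`
(a `27 × 27` integer identity, by `decide +kernel`; no `27 × 27` determinant is ever evaluated).
[folklore] -/
private theorem slStabCertMatrix_mul_apply :
    ∀ r c : Fin 3 × Fin 3 × Fin 3,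
      (slStabCertMatrix * sl3LieMatrix slStabCertTensor) r c = if r = c then (3 : ℤ) else 0 := by
  decide +kernel

/-- `slStabCertMatrix · sl3LieMatrix slStabCertTensor = 3 • 1`. [folklore] -/
private theorem slStabCertMatrix_mul :
    slStabCertMatrix * sl3LieMatrix slStabCertTensor =
      (3 : ℤ) • (1 : Matrix (Fin 3 × Fin 3 × Fin 3) (Fin 3 × Fin 3 × Fin 3) ℤ) := by
  ext r c
  rw [slStabCertMatrix_mul_apply, Matrix.smul_apply, Matrix.one_apply, smul_eq_mul, mul_ite,
    mul_one, mul_zero]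

/-- **Almost all `w ∈ ⊗³ℂ³` have zero traceless infinitesimal stabilizer** (off the hypersurface
`det (slStabCertMatrix · sl3LieMatrix w) = 0`, which misses `slStabCertTensor`).
[cite: BurgisserIkenmeyer2017, Thm. 4.2 and Prop. 4.10 (proof), case `m = 3`] -/
theorem isZariskiGenericTensor_hasTrivialSL3LieStabilizer_three :
    IsZariskiGenericTensor
      (fun w : Fin 3 → Fin 3 → Fin 3 → ℂ => HasTrivialSL3LieStabilizer w) :=
  isZariskiGenericTensor_hasTrivialSL3LieStabilizer_of_certificate slStabCertMatrix slStabCertTensor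
    3 (by norm_num) slStabCertMatrix_mul

/-- **Almost all `w ∈ ⊗³ℂ³` have a finite `SL₃ × SL₃ × SL₃`-stabilizer** — the generic
finiteness of `stab'(w)` on `⊗³ℂ³` used in the printed proof of BI 2017 Prop. 4.10 (there via the
classification of `⊗³ℂ³`; here by the Lie-algebra criterion and the rank certificate at
`slStabCertTensor`). This is VERBATIM the hypothesis `h3` of `BI2017_prop_4_10_of_popov` /
`BI2017_cor_5_12_of_popov` (`BI17Prop410OfPopov.lean`).
[cite: BurgisserIkenmeyer2017, Thm. 4.2 and Prop. 4.10 (proof), case `m = 3`] -/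
theorem isZariskiGenericTensor_finite_slStabilizer_three :
    IsZariskiGenericTensor fun w : Fin 3 → Fin 3 → Fin 3 → ℂ =>
      {g : Matrix.SpecialLinearGroup (Fin 3) ℂ × Matrix.SpecialLinearGroup (Fin 3) ℂ ×
          Matrix.SpecialLinearGroup (Fin 3) ℂ |
        actTensor (g.1 : Matrix (Fin 3) (Fin 3) ℂ) (g.2.1 : Matrix (Fin 3) (Fin 3) ℂ)
          (g.2.2 : Matrix (Fin 3) (Fin 3) ℂ) w = w}.Finite :=
  isZariskiGenericTensor_finite_slStabilizer_of_certificate slStabCertMatrix slStabCertTensor 3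
    (by norm_num) slStabCertMatrix_mul

end Three

/-! ### The edges of `BI17Prop410OfPopov.lean` with `h3` discharged -/

section Edges

/-- **BI 2017, Prop. 4.10 from Popov's two theorems, BY NAME** ("Almost all `w ∈ ⊗³ℂ^m` are
polystable"): the edge `BI2017_prop_4_10_of_popov` with its third input — generic finiteness of
the `SL₃³`-stabilizer on `⊗³ℂ³` — supplied by `isZariskiGenericTensor_finite_slStabilizer_three`.
`BI2017_prop_4_10 ⇐ {Popov1970_genericClosedOrbit_tensor, BI2017_popov_trivialStabilizer}`; an
edge, not a discharge. [cite: BurgisserIkenmeyer2017, Prop. 4.10] -/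
theorem BI2017_prop_4_10_of_popov70_popov87 (h70 : Popov1970_genericClosedOrbit_tensor)
    (h87 : BI2017_popov_trivialStabilizer) : BI2017_prop_4_10 :=
  BI2017_prop_4_10_of_popov h70 h87 isZariskiGenericTensor_finite_slStabilizer_three

/-- **BI 2017, Cor. 5.12 from Popov's two theorems, BY NAME**: the edge `BI2017_cor_5_12_of_popov`
with `h3` supplied. `BI2017_cor_5_12 ⇐ {Popov1970_genericClosedOrbit_tensor,
BI2017_popov_trivialStabilizer}`; an edge, not a discharge. [cite: BurgisserIkenmeyer2017, Cor. 5.12] -/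
theorem BI2017_cor_5_12_of_popov70_popov87 (h70 : Popov1970_genericClosedOrbit_tensor)
    (h87 : BI2017_popov_trivialStabilizer) : BI2017_cor_5_12 :=
  BI2017_cor_5_12_of_popov h70 h87 isZariskiGenericTensor_finite_slStabilizer_three

end Edges

end Literature.Computability.AlgebraicComplexity

end
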